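import Summits.MatrixMultiplication.MatrixMultiplication.Theorems.SoloInformedValInducedMatching

/-!
# SoloInformedValPerfectBlock — perfect blocks are rigid (normal-form triples)

Sequel of `SoloInformedValInducedMatching` (notation as there: potentials `x : I → G`, `y : J → G`,
`z : K → G` on an additive commutative group `G`, pair graphs `H_IJ, H_JK, H_KI`, the condition
`NoAccidental` = "no accidental solutions", and the triangles of the tripartite graph, whose images are the
solutions `a + b + c = 0` of the normal-form triple; K. Pratt, *On generalized corners and matrix
multiplication*, arXiv:2309.03878, Def. 3.2).

A COMPLETE SUB-BLOCK is a triple of vertex sets `I₀ ⊆ I`, `J₀ ⊆ J`, `K₀ ⊆ K` between which all three pair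
graphs are complete bipartite.  It is PERFECT when `|I₀| · |J₀| · |K₀| = |G|`.  (For a complete block the
absence of accidental solutions says exactly that `{x i}, {y j}, {z k}` restricted to the block satisfy the
triple product property, so a perfect block is a TPP triple `S, T, U` with `|S||T||U| = |G|`, e.g. the three
coordinate axes of `(ℤ/ℓ)³`.)

MAIN RESULTS (`G` finite, no accidental solutions).
* `NoAccidental.block_inj`: on a complete block the potential map `φ(i,j,k) = x i - y j - z k` is injective,
  and so is the sign-swapped map `x i - y j + z k` (`NoAccidental.block_inj'`); for a perfect block both are
  therefore onto `G` (`exists_block_eq_of_injOn`).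
* `NoAccidental.triangle_mem_perfectBlock` (RIGIDITY): if the configuration contains a perfect block, then
  EVERY triangle of the whole configuration lies in the block — no potential outside `I₀, J₀, K₀` and no edge
  outside the block lies on any triangle.  Hence `triangleSet = I₀ × J₀ × K₀`
  (`NoAccidental.triangleSet_eq_perfectBlock`) and the number of triangles is exactly `|G|`
  (`NoAccidental.card_triangleSet_perfectBlock`): a perfect block cannot be extended by a single solution.
* `NoAccidental.cube_le_perfectBlock`: consequently the inequality `T³ ≤ |G|² · |I| · |J| · |K|`
  ((U2𝒩) of the dossier, open in general) holds for every configuration containing a perfect block, with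
  equality iff the block exhausts the three index types.

PROOF OF RIGIDITY.  Let `(i,j,k)` be a triangle and `k₀ ∈ K₀`.  Since `φ` maps the block onto `G`, there
is a block triple `(i',j',k')` with `x i' - y j' - z k' = (x i - y j) - z k₀`, i.e.
`(x i - y j) + (y j' - z k₀) + (z k' - x i') = 0` with `(i,j) ∈ H_IJ`, `(j',k₀) ∈ H_JK`, `(k',i') ∈ H_KI`;
no accidental solutions forces `i = i' ∈ I₀` and `j = j' ∈ J₀`.  For `k` use the edge `(j,k) ∈ H_JK` in
the middle slot and the sign-swapped map: a block triple with `x i₁ - y j₁ + z k₁ = (z k - y j) + x i₀`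
gives `(x i₁ - y j₁) + (y j - z k) + (z k₁ - x i₀) = 0`, forcing `k = k₁ ∈ K₀`.

This is the structural fact behind the exhaustive checks of the dossier (`paper/val-superlinear.md`
(15.7)(b): no further potential can be attached to the axis blocks of `(ℤ/2)³`, `(ℤ/3)³`), now for every
finite abelian group and every perfect block.  solo-informed MatrixMultiplication, gen 76.  Elementary;
no `sorry`.
-/

namespace Summit.MatrixMultiplication.MatrixMultiplication.Theorems.SoloVal

open Finset

section Counting

variable {I J K : Type*} {I₀ : Finset I} {J₀ : Finset J} {K₀ : Finset K}

/-- A map that is injective on a block of `|M|` cells takes every value of `M` on the block. -/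
theorem exists_block_eq_of_injOn {M : Type*} [Fintype M] [DecidableEq M] (f : I × J × K → M)
    (hinj : Set.InjOn f ↑(I₀ ×ˢ (J₀ ×ˢ K₀)))
    (hcard : I₀.card * J₀.card * K₀.card = Fintype.card M) (g : M) :
    ∃ τ ∈ I₀ ×ˢ (J₀ ×ˢ K₀), f τ = g := by
  have himg : (I₀ ×ˢ (J₀ ×ˢ K₀)).image f = Finset.univ := by
    apply Finset.eq_univ_of_card
    rw [Finset.card_image_of_injOn hinj, Finset.card_product, Finset.card_product, ← mul_assoc, hcard]
  have hg : g ∈ (I₀ ×ˢ (J₀ ×ˢ K₀)).image f := by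
    rw [himg]
    exact Finset.mem_univ g
  obtain ⟨τ, hτ, hfτ⟩ := Finset.mem_image.mp hg
  exact ⟨τ, hτ, hfτ⟩

end Counting

section PerfectBlock

variable {G : Type*} [AddCommGroup G]
variable {I J K : Type*}
variable {x : I → G} {y : J → G} {z : K → G}
variable {HIJ : Finset (I × J)} {HJK : Finset (J × K)} {HKI : Finset (K × I)}
variable {I₀ : Finset I} {J₀ : Finset J} {K₀ : Finset K}

/-- On a complete block, no accidental solutions makes the potential map `x i - y j - z k` injective
(this is the triple product property of the block). -/
theorem NoAccidental.block_inj (hN : NoAccidental x y z HIJ HJK HKI)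
    (hIJ : ∀ i ∈ I₀, ∀ j ∈ J₀, (i, j) ∈ HIJ) (hJK : ∀ j ∈ J₀, ∀ k ∈ K₀, (j, k) ∈ HJK)
    (hKI : ∀ k ∈ K₀, ∀ i ∈ I₀, (k, i) ∈ HKI)
    {i i' : I} {j j' : J} {k k' : K} (hi : i ∈ I₀) (hi' : i' ∈ I₀) (hj : j ∈ J₀) (hj' : j' ∈ J₀)
    (hk : k ∈ K₀) (hk' : k' ∈ K₀) (h : x i - y j - z k = x i' - y j' - z k') :
    i = i' ∧ j = j' ∧ k = k' := by
  have hsum : (x i - y j) + (y j' - z k) + (z k' - x i') = 0 := by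
    calc (x i - y j) + (y j' - z k) + (z k' - x i')
        = (x i - y j - z k) - (x i' - y j' - z k') := by abel
      _ = 0 := by rw [h]; exact sub_self _
  exact hN i j j' k k' i' (hIJ i hi j hj) (hJK j' hj' k hk) (hKI k' hk' i' hi') hsum

/-- The sign-swapped potential map `x i - y j + z k` is injective on a complete block as well
(swap the roles of `k` and `k'`). -/
theorem NoAccidental.block_inj' (hN : NoAccidental x y z HIJ HJK HKI)
    (hIJ : ∀ i ∈ I₀, ∀ j ∈ J₀, (i, j) ∈ HIJ) (hJK : ∀ j ∈ J₀, ∀ k ∈ K₀, (j, k) ∈ HJK)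
    (hKI : ∀ k ∈ K₀, ∀ i ∈ I₀, (k, i) ∈ HKI)
    {i i' : I} {j j' : J} {k k' : K} (hi : i ∈ I₀) (hi' : i' ∈ I₀) (hj : j ∈ J₀) (hj' : j' ∈ J₀)
    (hk : k ∈ K₀) (hk' : k' ∈ K₀) (h : x i - y j + z k = x i' - y j' + z k') :
    i = i' ∧ j = j' ∧ k = k' := by
  have h' : x i - y j - z k' = x i' - y j' - z k := by
    have e : x i - y j - z k' = (x i - y j + z k) - z k - z k' := by abel
    rw [e, h]; abel
  obtain ⟨hii, hjj, hkk⟩ := hN.block_inj hIJ hJK hKI hi hi' hj hj' hk' hk h'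
  exact ⟨hii, hjj, hkk.symm⟩

/-- The potential map `φ = x - y - z` is injective on a complete block (set version). -/
theorem NoAccidental.phi_injOn_block (hN : NoAccidental x y z HIJ HJK HKI)
    (hIJ : ∀ i ∈ I₀, ∀ j ∈ J₀, (i, j) ∈ HIJ) (hJK : ∀ j ∈ J₀, ∀ k ∈ K₀, (j, k) ∈ HJK)
    (hKI : ∀ k ∈ K₀, ∀ i ∈ I₀, (k, i) ∈ HKI) :
    Set.InjOn (phi x y z) ↑(I₀ ×ˢ (J₀ ×ˢ K₀)) := by
  rintro ⟨i, j, k⟩ hτ ⟨i', j', k'⟩ hτ' h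
  simp only [Finset.coe_product, Set.mem_prod, Finset.mem_coe] at hτ hτ'
  obtain ⟨hi, hj, hk⟩ := hτ
  obtain ⟨hi', hj', hk'⟩ := hτ'
  simp only [phi] at h
  obtain ⟨rfl, rfl, rfl⟩ := hN.block_inj hIJ hJK hKI hi hi' hj hj' hk hk' h
  rfl

/-- The sign-swapped map `x - y + z` is injective on a complete block (set version). -/
theorem NoAccidental.phi'_injOn_block (hN : NoAccidental x y z HIJ HJK HKI)
    (hIJ : ∀ i ∈ I₀, ∀ j ∈ J₀, (i, j) ∈ HIJ) (hJK : ∀ j ∈ J₀, ∀ k ∈ K₀, (j, k) ∈ HJK)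
    (hKI : ∀ k ∈ K₀, ∀ i ∈ I₀, (k, i) ∈ HKI) :
    Set.InjOn (fun τ : I × J × K => x τ.1 - y τ.2.1 + z τ.2.2) ↑(I₀ ×ˢ (J₀ ×ˢ K₀)) := by
  rintro ⟨i, j, k⟩ hτ ⟨i', j', k'⟩ hτ' h
  simp only [Finset.coe_product, Set.mem_prod, Finset.mem_coe] at hτ hτ'
  obtain ⟨hi, hj, hk⟩ := hτ
  obtain ⟨hi', hj', hk'⟩ := hτ'
  simp only at h
  obtain ⟨rfl, rfl, rfl⟩ := hN.block_inj' hIJ hJK hKI hi hi' hj hj' hk hk' h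
  rfl

/-- RIGIDITY OF PERFECT BLOCKS.  If the configuration has no accidental solutions and contains a complete
block `I₀ × J₀ × K₀` with `|I₀||J₀||K₀| = |G|`, then every triangle of the whole configuration lies in the
block. -/
theorem NoAccidental.triangle_mem_perfectBlock [Fintype G] [DecidableEq G]
    (hN : NoAccidental x y z HIJ HJK HKI)
    (hIJ : ∀ i ∈ I₀, ∀ j ∈ J₀, (i, j) ∈ HIJ) (hJK : ∀ j ∈ J₀, ∀ k ∈ K₀, (j, k) ∈ HJK)
    (hKI : ∀ k ∈ K₀, ∀ i ∈ I₀, (k, i) ∈ HKI)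
    (hcard : I₀.card * J₀.card * K₀.card = Fintype.card G)
    {τ : I × J × K} (hτ : IsTriangle HIJ HJK HKI τ) : τ.1 ∈ I₀ ∧ τ.2.1 ∈ J₀ ∧ τ.2.2 ∈ K₀ := by
  obtain ⟨i, j, k⟩ := τ
  obtain ⟨h1, h2, h3⟩ := hτ
  -- a reference cell of the block (the block is nonempty because `G` is)
  obtain ⟨⟨i₀, j₀, k₀⟩, hm₀, -⟩ :=
    exists_block_eq_of_injOn (phi x y z) (hN.phi_injOn_block hIJ hJK hKI) hcard 0
  simp only [Finset.mem_product] at hm₀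
  obtain ⟨hi₀, -, hk₀⟩ := hm₀
  -- slot `a`: the edge `(i, j)` against the block
  obtain ⟨⟨i', j', k'⟩, hm', hphi⟩ :=
    exists_block_eq_of_injOn (phi x y z) (hN.phi_injOn_block hIJ hJK hKI) hcard ((x i - y j) - z k₀)
  simp only [Finset.mem_product] at hm'
  obtain ⟨hi', hj', hk'⟩ := hm'
  simp only [phi] at hphi
  have hsum : (x i - y j) + (y j' - z k₀) + (z k' - x i') = 0 := by
    calc (x i - y j) + (y j' - z k₀) + (z k' - x i')
        = ((x i - y j) - z k₀) - (x i' - y j' - z k') := by abel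
      _ = 0 := by rw [hphi]; exact sub_self _
  obtain ⟨hii', hjj', -⟩ := hN i j j' k₀ k' i' h1 (hJK j' hj' k₀ hk₀) (hKI k' hk' i' hi') hsum
  -- slot `b`: the edge `(j, k)` against the block, with the sign-swapped map
  obtain ⟨⟨i₁, j₁, k₁⟩, hm₁, hphi₁⟩ :=
    exists_block_eq_of_injOn (fun τ : I × J × K => x τ.1 - y τ.2.1 + z τ.2.2)
      (hN.phi'_injOn_block hIJ hJK hKI) hcard ((z k - y j) + x i₀)
  simp only [Finset.mem_product] at hm₁
  obtain ⟨hi₁, hj₁, hk₁⟩ := hm₁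
  simp only at hphi₁
  have hsum₁ : (x i₁ - y j₁) + (y j - z k) + (z k₁ - x i₀) = 0 := by
    calc (x i₁ - y j₁) + (y j - z k) + (z k₁ - x i₀)
        = (x i₁ - y j₁ + z k₁) - ((z k - y j) + x i₀) := by abel
      _ = 0 := by rw [hphi₁]; exact sub_self _
  obtain ⟨-, -, hkk₁⟩ := hN i₁ j₁ j k k₁ i₀ (hIJ i₁ hi₁ j₁ hj₁) h2 (hKI k₁ hk₁ i₀ hi₀) hsum₁
  refine ⟨?_, ?_, ?_⟩
  · show i ∈ I₀
    rw [hii']; exact hi'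
  · show j ∈ J₀
    rw [hjj']; exact hj'
  · show k ∈ K₀
    rw [hkk₁]; exact hk₁

/-- With a perfect block, the set of all triangles IS the block. -/
theorem NoAccidental.triangleSet_eq_perfectBlock [Fintype G] [DecidableEq G]
    [DecidableEq I] [DecidableEq J] [DecidableEq K]
    (hN : NoAccidental x y z HIJ HJK HKI)
    (hIJ : ∀ i ∈ I₀, ∀ j ∈ J₀, (i, j) ∈ HIJ) (hJK : ∀ j ∈ J₀, ∀ k ∈ K₀, (j, k) ∈ HJK)
    (hKI : ∀ k ∈ K₀, ∀ i ∈ I₀, (k, i) ∈ HKI)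
    (hcard : I₀.card * J₀.card * K₀.card = Fintype.card G) :
    triangleSet HIJ HJK HKI = I₀ ×ˢ (J₀ ×ˢ K₀) := by
  ext τ
  rw [mem_triangleSet, Finset.mem_product, Finset.mem_product]
  constructor
  · intro hτ
    exact hN.triangle_mem_perfectBlock hIJ hJK hKI hcard hτ
  · rintro ⟨hi, hj, hk⟩
    exact ⟨hIJ _ hi _ hj, hJK _ hj _ hk, hKI _ hk _ hi⟩

/-- RIGIDITY, counted: a configuration without accidental solutions that contains a perfect block has
exactly `|G|` triangles — the block cannot be extended by a single solution. -/
theorem NoAccidental.card_triangleSet_perfectBlock [Fintype G] [DecidableEq G]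
    [DecidableEq I] [DecidableEq J] [DecidableEq K]
    (hN : NoAccidental x y z HIJ HJK HKI)
    (hIJ : ∀ i ∈ I₀, ∀ j ∈ J₀, (i, j) ∈ HIJ) (hJK : ∀ j ∈ J₀, ∀ k ∈ K₀, (j, k) ∈ HJK)
    (hKI : ∀ k ∈ K₀, ∀ i ∈ I₀, (k, i) ∈ HKI)
    (hcard : I₀.card * J₀.card * K₀.card = Fintype.card G) :
    (triangleSet HIJ HJK HKI).card = Fintype.card G := by
  rw [hN.triangleSet_eq_perfectBlock hIJ hJK hKI hcard, Finset.card_product, Finset.card_product,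
    ← mul_assoc, hcard]

/-- No potential outside the block is used by any triangle: e.g. on the `I` side. -/
theorem NoAccidental.fst_mem_of_perfectBlock [Fintype G] [DecidableEq G]
    (hN : NoAccidental x y z HIJ HJK HKI)
    (hIJ : ∀ i ∈ I₀, ∀ j ∈ J₀, (i, j) ∈ HIJ) (hJK : ∀ j ∈ J₀, ∀ k ∈ K₀, (j, k) ∈ HJK)
    (hKI : ∀ k ∈ K₀, ∀ i ∈ I₀, (k, i) ∈ HKI)
    (hcard : I₀.card * J₀.card * K₀.card = Fintype.card G)
    {i : I} {j : J} {k : K} (hτ : IsTriangle HIJ HJK HKI (i, j, k)) : i ∈ I₀ :=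
  (hN.triangle_mem_perfectBlock hIJ hJK hKI hcard hτ).1

/-- (U2𝒩) FOR CONFIGURATIONS WITH A PERFECT BLOCK: `T³ ≤ |G|² · (|I| · |J| · |K|)`, where `T` is the number
of triangles; equality holds iff `|I₀||J₀||K₀| = |I||J||K|`, i.e. the block exhausts the index types. -/
theorem NoAccidental.cube_le_perfectBlock [Fintype G] [DecidableEq G]
    [Fintype I] [Fintype J] [Fintype K] [DecidableEq I] [DecidableEq J] [DecidableEq K]
    (hN : NoAccidental x y z HIJ HJK HKI)
    (hIJ : ∀ i ∈ I₀, ∀ j ∈ J₀, (i, j) ∈ HIJ) (hJK : ∀ j ∈ J₀, ∀ k ∈ K₀, (j, k) ∈ HJK)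
    (hKI : ∀ k ∈ K₀, ∀ i ∈ I₀, (k, i) ∈ HKI)
    (hcard : I₀.card * J₀.card * K₀.card = Fintype.card G) :
    (triangleSet HIJ HJK HKI).card ^ 3
      ≤ Fintype.card G ^ 2 * (Fintype.card I * Fintype.card J * Fintype.card K) := by
  rw [hN.card_triangleSet_perfectBlock hIJ hJK hKI hcard]
  have hle : Fintype.card G ≤ Fintype.card I * Fintype.card J * Fintype.card K := by
    rw [← hcard]
    exact Nat.mul_le_mul (Nat.mul_le_mul (Finset.card_le_univ I₀) (Finset.card_le_univ J₀))
      (Finset.card_le_univ K₀)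
  calc Fintype.card G ^ 3 = Fintype.card G ^ 2 * Fintype.card G := by ring
    _ ≤ Fintype.card G ^ 2 * (Fintype.card I * Fintype.card J * Fintype.card K) :=
      Nat.mul_le_mul_left _ hle

/-- The (U2𝒩) ratio is EXACTLY one when the perfect block exhausts the index types:
`T³ = |G|² · |I| · |J| · |K|`. -/
theorem NoAccidental.cube_eq_perfectBlock_univ [Fintype G] [DecidableEq G]
    [Fintype I] [Fintype J] [Fintype K] [DecidableEq I] [DecidableEq J] [DecidableEq K]
    (hN : NoAccidental x y z HIJ HJK HKI)
    (hIJ : ∀ i j, (i, j) ∈ HIJ) (hJK : ∀ j k, (j, k) ∈ HJK) (hKI : ∀ k i, (k, i) ∈ HKI)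
    (hcard : Fintype.card I * Fintype.card J * Fintype.card K = Fintype.card G) :
    (triangleSet HIJ HJK HKI).card ^ 3
      = Fintype.card G ^ 2 * (Fintype.card I * Fintype.card J * Fintype.card K) := by
  have hcard' : (Finset.univ : Finset I).card * (Finset.univ : Finset J).card
      * (Finset.univ : Finset K).card = Fintype.card G := by
    simpa only [Finset.card_univ] using hcard
  rw [hN.card_triangleSet_perfectBlock (I₀ := Finset.univ) (J₀ := Finset.univ) (K₀ := Finset.univ)
    (fun i _ j _ => hIJ i j) (fun j _ k _ => hJK j k) (fun k _ i _ => hKI k i) hcard', hcard]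
  ring

end PerfectBlock

end Summit.MatrixMultiplication.MatrixMultiplication.Theorems.SoloVal
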